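import Mathlib
import Summits.NavierStokesRegularity.NavierStokesRegularity.Theorems.WakeRatchetTailRatchetQuietPastFloor
import HarnessLib

/-!
# `WakeRatchet.TailRatchet` (stmt-NavierStokesRegularity-21808) — hypothesis class of the tail ratchets:
# smallness at ONE log-time propagates forward (bootstrap), and then DECAYS

Support file (route `WakeRatchet`; MODEL lattice ODEs of Tao 2016 §4 / §6.4 — nothing here concerns the Navier–Stokes
equations; no item is closed).  Third companion of `WakeRatchetTailRatchetQuietPast`.

The companion files show that an eternal solution which is quiet on a whole past HALF-LINE vanishes.  Here the hypothesis is
weakened to quietness at a SINGLE log-time `σ₁` (all shells `≤ δ`), for a uniformly bounded solution (`‖W_k‖ ≤ C`) of ANY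
table with ANY covariant viscosity `ν̂ ≥ 0` (`K` a bound of the table constant `C_Q + Λ C_A + Λ⁻¹ C_B`):

* `sq_le_sq_add` — one-sided Lipschitz bound `‖W_k(s)‖² ≤ ‖W_k(u)‖² + 2KC³(s − u)` (`u ≤ s`): shells cannot grow fast;
* `bootstrap_two_delta` — if `K δ h ≤ 1/8` then all shells stay `≤ 2δ` on `[σ₁, σ₁ + h]` (a DISCRETE continuity argument:
  the window estimate of the companion file gives `≤ √3 δ` as long as the bound `2δ` holds, and the Lipschitz bound carries
  `√3 δ ↦ 2δ` across steps of length `δ²/(2KC³+1)`);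
* `half_at_end` — with `h = 1/(8Kδ)` and `K δ ≤ 1/64` the shells have decayed to `≤ δ/2` at `σ₁ + h`.

The fourth companion (`…QuietPastUniform`) iterates this over epochs of doubling length and derives the UNIFORM backward
floor: a non-trivial uniformly bounded eternal solution satisfies `sup_k ‖W_k(σ)‖ > 1/(64K)` for ALL sufficiently negative `σ`.

HONEST FRAMING: elementary real analysis for a MODEL lattice ODE; stmt-21808 is neither proved nor refuted here (dead modulo
the construction `WakeRatchetDyadicFront.DyadicScalarFronts`).
-/

noncomputable section

set_option linter.dupNamespace false

namespace Summit.NavierStokesRegularity.NavierStokesRegularity.Theorems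

namespace WakeRatchetQuietPast

open Set Filter Topology
open scoped RealInnerProductSpace
open Literature.Analysis.FluidPDE Literature.Analysis.FluidPDE.TaoCascade

variable {m : ℕ} {ε₀ νh : ℝ} {α : Fin m → Fin m → Fin m → ℤ × ℤ × ℤ → ℝ} {W : ℤ → ℝ → Em m}

/-! ## One-sided Lipschitz bound: shells cannot grow fast -/

/-- **Derivative of the shell energy along the law.**  `(‖W_k‖²)' = 2(⟨W_k, N_k⟩ − (1+v)‖W_k‖²) ≤ 2‖W_k‖‖N_k‖`
(`N_k` the quadratic part, `v ≥ 0` the viscous coefficient).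
[cite: Tao2016AveragedNS, §4 Lemma 4.1 (4.8)–(4.10), §6.4; cell lemma] -/
theorem hasDerivAt_sq (hε : -1 < ε₀) (hW : IsEternalVisc ε₀ νh α W) (k : ℤ) (u : ℝ) :
    ∃ d : ℝ, HasDerivAt (fun y => ‖W k y‖ ^ 2) d u ∧
      d ≤ 2 * (‖W k u‖ * ‖tableQ α (W k u) + bigLam ε₀ • tableA α (W (k - 1) u)
          + (bigLam ε₀)⁻¹ • tableB α (W (k + 1) u) (W k u)‖) := by
  have hlaw := hW.law k u
  set N : Em m := tableQ α (W k u) + bigLam ε₀ • tableA α (W (k - 1) u)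
    + (bigLam ε₀)⁻¹ • tableB α (W (k + 1) u) (W k u) with hN
  set v : ℝ := νh * ((1 + ε₀) ^ ((2 : ℝ) * k) * Real.exp (-u)) with hv
  have hderiv_eq : -((1 : ℝ) • W k u) + tableQ α (W k u) + bigLam ε₀ • tableA α (W (k - 1) u)
      + (bigLam ε₀)⁻¹ • tableB α (W (k + 1) u) (W k u) - v • W k u = N - (1 + v) • W k u := by
    rw [hN, add_smul, one_smul]; abel
  have hlaw' : HasDerivAt (W k) (N - (1 + v) • W k u) u := hlaw.congr_deriv hderiv_eq
  refine ⟨_, hlaw'.norm_sq, ?_⟩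
  have hinner : ⟪W k u, N - (1 + v) • W k u⟫ = ⟪W k u, N⟫ - (1 + v) * ‖W k u‖ ^ 2 := by
    rw [inner_sub_right, inner_smul_right, real_inner_self_eq_norm_sq]
  have hv0 : 0 ≤ v := by
    rw [hv]
    have hb : 0 < (1 + ε₀) ^ ((2 : ℝ) * k) := Real.rpow_pos_of_pos (by linarith) _
    exact mul_nonneg hW.nonneg (mul_nonneg hb.le (Real.exp_pos _).le)
  have hWN : ⟪W k u, N⟫ ≤ ‖W k u‖ * ‖N‖ := real_inner_le_norm _ _
  have hvW : 0 ≤ v * ‖W k u‖ ^ 2 := mul_nonneg hv0 (sq_nonneg _)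
  rw [hinner]
  nlinarith [hWN, hvW, sq_nonneg ‖W k u‖]

/-- **One-sided Lipschitz bound.**  If `‖W_j‖ ≤ C` for all shells and log-times (`C ≥ 0`), then for `u ≤ s`:
`‖W_k(s)‖² ≤ ‖W_k(u)‖² + 2 K C³ (s − u)` — a shell's energy grows at rate at most `2KC³` (it may decay arbitrarily fast).
[cite: Tao2016AveragedNS, §4 Lemma 4.1 (4.8); cell lemma] -/
theorem sq_le_sq_add (hε : -1 < ε₀) (hW : IsEternalVisc ε₀ νh α W) {K C : ℝ}
    (hK : shiftConst α (0, 0, 0) + bigLam ε₀ * shiftConst α (0, 0, 1)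
      + (bigLam ε₀)⁻¹ * (shiftConst α (1, 0, 0) + shiftConst α (0, 1, 0)) ≤ K)
    (hC0 : 0 ≤ C) (hC : ∀ (j : ℤ) (σ : ℝ), ‖W j σ‖ ≤ C) (k : ℤ) {u s : ℝ} (hus : u ≤ s) :
    ‖W k s‖ ^ 2 ≤ ‖W k u‖ ^ 2 + 2 * K * C ^ 3 * (s - u) := by
  set g : ℝ → ℝ := fun y => ‖W k y‖ ^ 2 - 2 * K * C ^ 3 * y with hg
  have hgd : ∀ y, HasDerivAt g (deriv g y) y ∧ deriv g y ≤ 0 := by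
    intro y
    obtain ⟨d, hd, hdle⟩ := hasDerivAt_sq hε hW k y
    have hlin : HasDerivAt (fun y : ℝ => 2 * K * C ^ 3 * y) (2 * K * C ^ 3) y := by
      simpa using (hasDerivAt_id y).const_mul (2 * K * C ^ 3)
    have hgy : HasDerivAt g (d - 2 * K * C ^ 3) y := hd.sub hlin
    have hN : ‖tableQ α (W k y) + bigLam ε₀ • tableA α (W (k - 1) y)
        + (bigLam ε₀)⁻¹ • tableB α (W (k + 1) y) (W k y)‖ ≤ K * C ^ 2 :=
      norm_quad_le_of_bound hε hK hC0 (hC k y) (hC (k - 1) y) (hC (k + 1) y)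
    have hprod := mul_le_mul (hC k y) hN (norm_nonneg _) hC0
    rw [hgy.deriv]
    refine ⟨hgy, ?_⟩
    nlinarith [hdle, hprod]
  have hdiff : Differentiable ℝ g := fun y => (hgd y).1.differentiableAt
  have hanti : Antitone g := antitone_of_deriv_nonpos hdiff fun y => (hgd y).2
  have h := hanti hus
  simp only [hg] at h
  linarith

/-! ## The bootstrap: smallness at one log-time propagates for a while -/

/-- From `x² ≤ 4 δ²`, `0 ≤ x`, `0 ≤ δ`: `x ≤ 2δ`. [folklore] -/
theorem le_two_mul_of_sq_le {x δ : ℝ} (hx : 0 ≤ x) (hδ : 0 ≤ δ) (h : x ^ 2 ≤ 4 * δ ^ 2) : x ≤ 2 * δ := by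
  have h' : x ^ 2 ≤ (2 * δ) ^ 2 := by nlinarith [h]
  exact (pow_le_pow_iff_left₀ hx (by positivity) two_ne_zero).1 h'

/-- `e^{2b} − e^{2a} ≤ 2 (b − a) e^{2b}` (any `a, b`; from `1 − x ≤ e^{−x}`). [folklore] -/
theorem exp_gap_le (a b : ℝ) :
    Real.exp (2 * b) - Real.exp (2 * a) ≤ 2 * (b - a) * Real.exp (2 * b) := by
  have hexp : 0 < Real.exp (2 * b) := Real.exp_pos _
  have h1 : 1 - 2 * (b - a) ≤ Real.exp (-(2 * (b - a))) := by
    linarith [Real.add_one_le_exp (-(2 * (b - a)))]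
  have h2 : Real.exp (2 * a) = Real.exp (2 * b) * Real.exp (-(2 * (b - a))) := by
    rw [← Real.exp_add]; ring_nf
  rw [h2]
  nlinarith [mul_le_mul_of_nonneg_left h1 hexp.le]

/-- **Inside the bootstrap: `≤ 2δ` on `[σ₁, u₀]` gives `≤ √3·δ` at `u₀`** (window estimate with `D = 2δ`, `u₀ − σ₁ ≤ h`,
`K δ h ≤ 1/8`). [cite: Tao2016AveragedNS, §4 Lemma 4.1 (4.8); cell lemma] -/
theorem sq_le_three_of_two_delta (hε : -1 < ε₀) (hW : IsEternalVisc ε₀ νh α W) {K δ h σ₁ u₀ : ℝ}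
    (hK : shiftConst α (0, 0, 0) + bigLam ε₀ * shiftConst α (0, 0, 1)
      + (bigLam ε₀)⁻¹ * (shiftConst α (1, 0, 0) + shiftConst α (0, 1, 0)) ≤ K)
    (hδ : 0 ≤ δ) (hKδh : K * δ * h ≤ 1 / 8) (hq : ∀ k : ℤ, ‖W k σ₁‖ ≤ δ)
    (hu₀ : σ₁ ≤ u₀) (hu₀h : u₀ ≤ σ₁ + h)
    (hbd : ∀ (k : ℤ) (u : ℝ), u ∈ Icc σ₁ u₀ → ‖W k u‖ ≤ 2 * δ) (k : ℤ) :
    ‖W k u₀‖ ^ 2 ≤ 3 * δ ^ 2 := by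
  have hK0 : 0 ≤ K := tableConst_nonneg hε hK
  have hwin := weighted_sq_le hε hW hK (by positivity : (0 : ℝ) ≤ 2 * δ) hbd k u₀ ⟨hu₀, le_rfl⟩
  have hexp : 0 < Real.exp (2 * u₀) := Real.exp_pos _
  have hexp1 : Real.exp (2 * σ₁) ≤ Real.exp (2 * u₀) := Real.exp_le_exp.2 (by linarith)
  have hgap := exp_gap_le σ₁ u₀
  have hq2 : ‖W k σ₁‖ ^ 2 ≤ δ ^ 2 := pow_le_pow_left₀ (norm_nonneg _) (hq k) 2
  have hKd : 0 ≤ K * (2 * δ) ^ 3 := by positivity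
  -- `e^{2u₀}‖W_k(u₀)‖² ≤ e^{2u₀} δ² + K (2δ)³ · 2h · e^{2u₀}`
  have h1 : Real.exp (2 * σ₁) * ‖W k σ₁‖ ^ 2 ≤ Real.exp (2 * u₀) * δ ^ 2 := by
    calc Real.exp (2 * σ₁) * ‖W k σ₁‖ ^ 2 ≤ Real.exp (2 * σ₁) * δ ^ 2 :=
          mul_le_mul_of_nonneg_left hq2 (Real.exp_pos _).le
      _ ≤ Real.exp (2 * u₀) * δ ^ 2 := mul_le_mul_of_nonneg_right hexp1 (sq_nonneg _)
  have h2 : K * (2 * δ) ^ 3 * (Real.exp (2 * u₀) - Real.exp (2 * σ₁))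
      ≤ K * (2 * δ) ^ 3 * (2 * h * Real.exp (2 * u₀)) := by
    refine mul_le_mul_of_nonneg_left (hgap.trans ?_) hKd
    have : u₀ - σ₁ ≤ h := by linarith
    nlinarith [this, hexp]
  have h3 : Real.exp (2 * u₀) * ‖W k u₀‖ ^ 2 ≤
      Real.exp (2 * u₀) * (δ ^ 2 + 16 * (K * δ * h) * δ ^ 2) := by
    have e : Real.exp (2 * u₀) * δ ^ 2 + K * (2 * δ) ^ 3 * (2 * h * Real.exp (2 * u₀))
        = Real.exp (2 * u₀) * (δ ^ 2 + 16 * (K * δ * h) * δ ^ 2) := by ring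
    rw [← e]; linarith [hwin, h1, h2]
  have h4 : ‖W k u₀‖ ^ 2 ≤ δ ^ 2 + 16 * (K * δ * h) * δ ^ 2 := le_of_mul_le_mul_left h3 hexp
  nlinarith [h4, hKδh, sq_nonneg δ]

/-- **Bootstrap.**  Let `‖W_j‖ ≤ C` everywhere (`C ≥ 0`), all shells `≤ δ` at log-time `σ₁` (`δ ≥ 0`), and `h ≥ 0` with
`K δ h ≤ 1/8`.  Then all shells stay `≤ 2δ` on `[σ₁, σ₁ + h]`.  (Discrete continuity argument with steps of length
`τ = δ²/(2KC³+1)`: on the covered part the window estimate improves `2δ` to `√3 δ`, and the one-sided Lipschitz bound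
loses at most `δ²` over one step.) [cite: Tao2016AveragedNS, §4 Lemma 4.1 (4.8); cell theorem] -/
theorem bootstrap_two_delta (hε : -1 < ε₀) (hW : IsEternalVisc ε₀ νh α W) {K C δ h σ₁ : ℝ}
    (hK : shiftConst α (0, 0, 0) + bigLam ε₀ * shiftConst α (0, 0, 1)
      + (bigLam ε₀)⁻¹ * (shiftConst α (1, 0, 0) + shiftConst α (0, 1, 0)) ≤ K)
    (hC0 : 0 ≤ C) (hC : ∀ (j : ℤ) (σ : ℝ), ‖W j σ‖ ≤ C) (hδ : 0 ≤ δ) (hq : ∀ k : ℤ, ‖W k σ₁‖ ≤ δ)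
    (hh : 0 ≤ h) (hKδh : K * δ * h ≤ 1 / 8) :
    ∀ (k : ℤ) (u : ℝ), u ∈ Icc σ₁ (σ₁ + h) → ‖W k u‖ ≤ 2 * δ := by
  have hK0 : 0 ≤ K := tableConst_nonneg hε hK
  rcases hδ.eq_or_lt with hδ0 | hδpos
  · -- `δ = 0`: the solution vanishes at `σ₁`, hence afterwards (forward uniqueness)
    intro k u hu
    have h0 : ∀ j : ℤ, W j σ₁ = 0 := fun j => by
      have := hq j; rw [← hδ0] at this; exact norm_le_zero_iff.1 this
    have := eq_zero_after_of_eq_zero hε hW ⟨C, hC⟩ hK h0 k u hu.1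
    rw [this, norm_zero]; linarith
  -- `δ > 0`: discrete bootstrap with step `τ`
  set τ : ℝ := δ ^ 2 / (2 * K * C ^ 3 + 1) with hτ
  have hden : 0 < 2 * K * C ^ 3 + 1 := by positivity
  have hτ0 : 0 < τ := by rw [hτ]; positivity
  have hτK : 2 * K * C ^ 3 * τ ≤ δ ^ 2 := by
    rw [hτ, show 2 * K * C ^ 3 * (δ ^ 2 / (2 * K * C ^ 3 + 1)) = (2 * K * C ^ 3) / (2 * K * C ^ 3 + 1) * δ ^ 2
      by ring]
    have : (2 * K * C ^ 3) / (2 * K * C ^ 3 + 1) ≤ 1 := by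
      rw [div_le_one hden]; linarith
    nlinarith [this, sq_nonneg δ]
  have hI : ∀ i : ℕ, ∀ (k : ℤ) (u : ℝ), u ∈ Icc σ₁ (σ₁ + min ((i : ℝ) * τ) h) → ‖W k u‖ ≤ 2 * δ := by
    intro i
    induction i with
    | zero =>
      intro k u hu
      simp only [Nat.cast_zero, zero_mul, min_eq_left hh, add_zero] at hu
      have : u = σ₁ := le_antisymm hu.2 hu.1
      rw [this]; linarith [hq k]
    | succ i ih =>
      intro k u hu
      by_cases hle : u ≤ σ₁ + min ((i : ℝ) * τ) h
      · exact ih k u ⟨hu.1, hle⟩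
      · push Not at hle
        -- then `min (i τ) h = i τ`, and `u₀ := σ₁ + i τ < u ≤ u₀ + τ`, `u ≤ σ₁ + h`
        have huh : u ≤ σ₁ + h := hu.2.trans (by linarith [min_le_right (((i + 1 : ℕ) : ℝ) * τ) h])
        have hmin : min ((i : ℝ) * τ) h = (i : ℝ) * τ := by
          rcases le_total ((i : ℝ) * τ) h with h1 | h1
          · exact min_eq_left h1
          · exfalso; rw [min_eq_right h1] at hle; linarith
        rw [hmin] at hle ih
        set u₀ : ℝ := σ₁ + (i : ℝ) * τ with hu₀
        have hu₀σ : σ₁ ≤ u₀ := by rw [hu₀]; nlinarith [hτ0.le]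
        have hu₀h : u₀ ≤ σ₁ + h := by linarith
        have huu₀ : u - u₀ ≤ τ := by
          have := hu.2.trans (by linarith [min_le_left (((i + 1 : ℕ) : ℝ) * τ) h] :
            σ₁ + min (((i + 1 : ℕ) : ℝ) * τ) h ≤ σ₁ + ((i + 1 : ℕ) : ℝ) * τ)
          push_cast at this
          rw [hu₀]; linarith
        have h3 := sq_le_three_of_two_delta hε hW hK hδ hKδh hq hu₀σ hu₀h ih k
        have hlip := sq_le_sq_add hε hW hK hC0 hC k hle.le
        have h4 : ‖W k u‖ ^ 2 ≤ 4 * δ ^ 2 := by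
          have : 2 * K * C ^ 3 * (u - u₀) ≤ δ ^ 2 :=
            (mul_le_mul_of_nonneg_left huu₀ (by positivity)).trans hτK
          linarith [h3, hlip, this]
        exact le_two_mul_of_sq_le (norm_nonneg _) hδ h4
  intro k u hu
  obtain ⟨i, hi⟩ := exists_nat_ge (h / τ)
  have hih : h ≤ (i : ℝ) * τ := by rwa [div_le_iff₀ hτ0] at hi
  have := hI i k u
  rw [min_eq_right hih] at this
  exact this hu

/-! ## Decay at the end of a long window -/

/-- **Halving.**  If moreover `0 < δ`, `0 < K`, `K δ ≤ 1/64` and `h = 1/(8Kδ)` (so `K δ h = 1/8`), then at the end of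
the window every shell is `≤ δ/2`: `‖W_k(σ₁ + h)‖² ≤ δ² e^{−2h} + 8Kδ³ ≤ δ²/8 + δ²/8`.
[cite: Tao2016AveragedNS, §4 Lemma 4.1 (4.8); cell theorem] -/
theorem half_at_end (hε : -1 < ε₀) (hW : IsEternalVisc ε₀ νh α W) {K C δ σ₁ : ℝ}
    (hK : shiftConst α (0, 0, 0) + bigLam ε₀ * shiftConst α (0, 0, 1)
      + (bigLam ε₀)⁻¹ * (shiftConst α (1, 0, 0) + shiftConst α (0, 1, 0)) ≤ K)
    (hK0 : 0 < K) (hC0 : 0 ≤ C) (hC : ∀ (j : ℤ) (σ : ℝ), ‖W j σ‖ ≤ C) (hδ : 0 < δ) (hKδ : K * δ ≤ 1 / 64)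
    (hq : ∀ k : ℤ, ‖W k σ₁‖ ≤ δ) : ∀ k : ℤ, ‖W k (σ₁ + 1 / (8 * K * δ))‖ ≤ δ / 2 := by
  intro k
  set h : ℝ := 1 / (8 * K * δ) with hh
  have hh0 : 0 < h := by rw [hh]; positivity
  have hKδh : K * δ * h ≤ 1 / 8 := by
    rw [hh, show K * δ * (1 / (8 * K * δ)) = 1 / 8 by field_simp]
  have hbd := bootstrap_two_delta hε hW hK hC0 hC hδ.le hq hh0.le hKδh
  have hwin := weighted_sq_le hε hW hK (by positivity : (0 : ℝ) ≤ 2 * δ) hbd k (σ₁ + h)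
    ⟨by linarith, le_rfl⟩
  -- `e^{2σ₁} = e^{2(σ₁+h)} e^{-2h}` and `e^{-2h} ≤ 1/8`
  have hexp : 0 < Real.exp (2 * (σ₁ + h)) := Real.exp_pos _
  have h2h : 16 ≤ 2 * h := by
    rw [hh]
    have hKδpos : 0 < K * δ := mul_pos hK0 hδ
    rw [show 2 * (1 / (8 * K * δ)) = 1 / (4 * (K * δ)) by field_simp; ring]
    rw [le_div_iff₀ (by positivity)]
    nlinarith [hKδ]
  have hem : Real.exp (-(2 * h)) ≤ 1 / 8 := by
    have h1 : 1 + 2 * h ≤ Real.exp (2 * h) := by linarith [Real.add_one_le_exp (2 * h)]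
    have h2 : Real.exp (-(2 * h)) = 1 / Real.exp (2 * h) := by rw [Real.exp_neg, one_div]
    rw [h2, div_le_div_iff₀ (Real.exp_pos _) (by norm_num : (0 : ℝ) < 8)]
    linarith
  have hσ₁ : Real.exp (2 * σ₁) = Real.exp (2 * (σ₁ + h)) * Real.exp (-(2 * h)) := by
    rw [← Real.exp_add]; ring_nf
  have hq2 : ‖W k σ₁‖ ^ 2 ≤ δ ^ 2 := pow_le_pow_left₀ (norm_nonneg _) (hq k) 2
  have hA : Real.exp (2 * σ₁) * ‖W k σ₁‖ ^ 2 ≤ Real.exp (2 * (σ₁ + h)) * (δ ^ 2 / 8) := by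
    rw [hσ₁]
    have := mul_le_mul hem hq2 (sq_nonneg _) (by norm_num : (0 : ℝ) ≤ 1 / 8)
    nlinarith [this, hexp]
  have hB : K * (2 * δ) ^ 3 * (Real.exp (2 * (σ₁ + h)) - Real.exp (2 * σ₁))
      ≤ Real.exp (2 * (σ₁ + h)) * (δ ^ 2 / 8) := by
    have h1 : Real.exp (2 * (σ₁ + h)) - Real.exp (2 * σ₁) ≤ Real.exp (2 * (σ₁ + h)) := by
      linarith [Real.exp_pos (2 * σ₁)]
    have h2 : K * (2 * δ) ^ 3 ≤ δ ^ 2 / 8 := by nlinarith [hKδ, sq_nonneg δ, hδ]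
    have h3 : 0 ≤ K * (2 * δ) ^ 3 := by positivity
    calc K * (2 * δ) ^ 3 * (Real.exp (2 * (σ₁ + h)) - Real.exp (2 * σ₁))
        ≤ K * (2 * δ) ^ 3 * Real.exp (2 * (σ₁ + h)) := mul_le_mul_of_nonneg_left h1 h3
      _ ≤ (δ ^ 2 / 8) * Real.exp (2 * (σ₁ + h)) := mul_le_mul_of_nonneg_right h2 hexp.le
      _ = _ := by ring
  have hsq : ‖W k (σ₁ + h)‖ ^ 2 ≤ δ ^ 2 / 4 := by
    have : Real.exp (2 * (σ₁ + h)) * ‖W k (σ₁ + h)‖ ^ 2 ≤ Real.exp (2 * (σ₁ + h)) * (δ ^ 2 / 4) := by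
      linarith [hwin, hA, hB]
    exact le_of_mul_le_mul_left this hexp
  have h' : ‖W k (σ₁ + h)‖ ^ 2 ≤ (δ / 2) ^ 2 := by nlinarith [hsq]
  exact (pow_le_pow_iff_left₀ (norm_nonneg _) (by positivity) two_ne_zero).1 h'

end WakeRatchetQuietPast

end Summit.NavierStokesRegularity.NavierStokesRegularity.Theorems

end
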